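import Literature.NumberTheory.EllipticCurves.GreenbergSelmer
import HarnessLib

/-!
# Greenberg's Selmer group of a newform's Galois representation over `K_∞`, and its `Λ_𝒪`-dual

Emerton–Pollack–Weston, *Variation of Iwasawa invariants in Hida families*, Invent. Math. 163 (2006),
§3.1 (arXiv:math/0404484, p. 17 of the held text), VERBATIM: "Let `f` be a `p`-ordinary and
`p`-stabilized newform of weight `k ≥ 2` … `K` the finite extension of `ℚ_p` generated by the Fourier
coefficients of `f` and `𝒪` the ring of integers of `K` … `ρ_f : G_ℚ → GL₂(𝒪)` [the integral model]
… let `A_f` denote a cofree `𝒪`-module of corank `2` with `G_ℚ`-action via `ρ_f` … an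
`𝒪[G_p]`-equivariant exact sequence `0 → (K/𝒪)(ε^{k-1}χφ⁻¹) → A_f → (K/𝒪)(φ) → 0` [(eq:ordes),
`φ` unramified]. We write `A_f'` (resp. `A_f''`) for the submodule (resp. quotient module) … For a
place `v` of `ℚ_∞` define `H¹_s(ℚ_{∞,v}, A_f) = H¹(ℚ_{∞,v}, A_f)` (`v ≠ v_p`),
`= im (H¹(ℚ_{∞,v_p}, A_f) → H¹(I_{v_p}, A_f''))` (`v = v_p`). Following [Greenberg 1989], the Selmer
group of `A_f` is defined by `Sel(ℚ_∞, A_f) = ker (H¹(ℚ_∞, A_f) → ∏_v H¹_s(ℚ_{∞,v}, A_f))` … We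
regard `Sel(ℚ_∞, A_f)` as a `Λ_𝒪`-module via the natural action of `Γ`. … `μ^alg(f)` (resp.
`λ^alg(f)`) is defined to be the largest power of `π` dividing (resp. the number of zeroes of) the
characteristic power series of the `Λ_𝒪`-dual of `Sel(ℚ_∞, A_f)`. **Theorem 3.1.1.** … `Sel(ℚ_∞, A_f)`
is co-finitely generated, `Λ_𝒪`-cotorsion … `μ^alg(f)` vanishes if and only if `Sel(ℚ_∞, A_f)[π]`
is finite. If this is the case, then `Sel(ℚ_∞, A_f)` is `𝒪`-divisible and
`λ^alg(f) = dim_k Sel(ℚ_∞, A_f)[π]`."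

This file (part 2 of the (V-alg) vocabulary requested in `run/shared/lean/b2b/bsd-rank1-residual/
b2b-bsdres-x11a/GL2-VOCAB-SPEC.md`; part 1 = `GreenbergSelmer.lean`, the generic Selmer group of a
discrete `Γ_K`-module over `L = K̄^H`) supplies, in the vocabulary of the tree
(`GaloisRepresentations.FramedRep` / `FramedGaloisRep`, `ZpExtension`, `SubgroupSelmer` §(a)):

* `lattice n 𝒪 F = 𝒪ⁿ ⊆ Fⁿ`, `fracRepresentation F ρ` (`ρ ⊗ F`, `𝒪`-linearly), and the **cofree
  module `Cofree ρ F = Fⁿ/𝒪ⁿ = T ⊗_𝒪 F/𝒪`** of a framed representation `ρ : G →ₜ* GL_n(𝒪)`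
  (Greenberg's `A_p = V_p/T_p`, EPW's `A_f`), a type synonym with the discrete topology, its
  `𝒪`-module structure and the `G`-action through `ρ` (`cofreeRepresentation`, Mathlib
  `Representation.quotient`; instances `instDistribMulActionCofree`, `instSMulCommClassCofree`), so
  that the generic `H¹(H, A) = subgroupH1 H (Cofree ρ F)` of `SubgroupSelmer` applies;
* `PlusPart ρ v` (a `D_v`-stable sublattice `T⁺_v ≤ 𝒪ⁿ`, Greenberg's `F⁺`), its local datum
  `P.localDatum F` on `A` (`A'_v = T⁺_v ⊗ F/𝒪`, `PlusPart.cofreePlus`), and for `n = 2` the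
  hypothesis structure **`OrdinaryFiltration ρ v`** = (eq:ordes): a `D_v`-stable rank-one direct
  summand with unramified quotient;
* **`greenbergSelmer F κ ρ P = Sel(K_∞, A)`** for a `ℤ_p`-extension `κ` of a number field `K` and
  plus-parts `P` at the places above `p` (= `GreenbergSelmer.selmerInfty κ (Cofree ρ F) (plusData)`),
  the strict variant, and the two PROVED stabilities `conjH1_mem_greenbergSelmer` (the `Γ`-action)
  and `scalarH1_mem_greenbergSelmer` (the `𝒪`-module structure);
* the `π`-torsion **`greenbergSelmerTorsionBy F κ ρ P π = Sel(K_∞, A)[π]`** with the quantity of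
  EPW Thm. 3.1.1 `selmerTorsionDim` (`dim_k Sel[π] = log_{#k} #Sel[π]`, = `λ^alg` when `μ^alg = 0` by
  the theorem; `μ^alg = 0` ⟺ `Finite (greenbergSelmerTorsionBy …)` by the theorem) — the "light"
  currency of GL2-VOCAB-SPEC §5;
* the hypothesis structure **`DualData F κ γ ρ P`** — the `Λ_𝒪 = 𝒪⟦T⟧`-dual of `Sel(K_∞, A)`,
  verbatim `WeierstrassCurve.SelmerDualData` (file `IwasawaSelmer`) with `𝒪` for `ℤ_p` (`T ↦ γ - 1`
  through `conjH1`, constants through `scalarH1`) — with `DualData.charIdeal` (the tree's generic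
  `Module.charIdeal`) — the "full" currency (`L_p^alg(f)` = a generator of `charIdeal`, EPW §5.1);
  cotorsion / finite generation are spelled `Module.IsTorsion (PowerSeries 𝒪) D.X` /
  `Module.Finite (PowerSeries 𝒪) D.X` (no predicate abbreviations, to keep the fact census at zero).

For `K = ℚ`, `n = 2`, `ρ = ρ_f`, `κ` cyclotomic and `P` the ordinary filtration this is
`Sel(ℚ_∞, A_f)` of EPW §3.1 with `i = 0` (= Greenberg's `S_{A_f}(ℚ_∞)`).

## Design notes

* Everything is a definition with a body, an instance, or a proved lemma; NO fact is vendored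
  (existence/uniqueness of dual data, cotorsion [Kato], EPW Thm. 3.1.1 are not asserted — statements
  consume `D : DualData …`, `Module.IsTorsion (PowerSeries 𝒪) D.X`, `Finite (greenbergSelmerTorsionBy …)`
  as hypotheses).
* `Cofree (_ρ) F` only tags the quotient type with `ρ` so that the action can be an instance (the
  idiom of Mathlib's `Representation.asModule`); the action needs no continuity hypothesis (the
  generic `discreteContRep` of file `GaloisAction` only uses that each `g` acts continuously on the
  discrete `A`), exactly as for `E[p^∞]` in `SubgroupSelmer`/`IwasawaSelmer`.
* `μ^alg`, `λ^alg` as functions of the dual are NOT defined here (they need a generator of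
  `charIdeal`; statements quantify `∀ f, D.charIdeal = Ideal.span {f} → …` as the tree's
  Greenberg–Vatsal / Skinner / EPW facts do, and use `GreenbergVatsal2000.HasUnitContent f` /
  a Weierstrass-degree function of `f`).
* `-- TODO(general form)`: the twists `A_{f,i} = A_f ⊗ ω^i` (`0 ≤ i ≤ p - 2`) of EPW §3.1; the bridge
  `Sel(ℚ_∞, E[p^∞])_{Greenberg} ⊇ Sel_{p^∞}(E/ℚ_∞)` with corank-`e` quotient (Greenberg, LNM 1716,
  Prop. 2.4; Skinner 2016 §3.2), for which `GreenbergSelmer.selmerInfty κ (geomPrimaryTorsion W p)` of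
  part 1 is directly comparable with `WeierstrassCurve.selmerInfty κ` (same carrier).

## References

* M. Emerton, R. Pollack, T. Weston, Invent. Math. 163 (2006), §3.1, Thm. 3.1.1, §5.1.
  [EmertonPollackWeston2006]
* R. Greenberg, *Iwasawa theory for p-adic representations*, Adv. Stud. Pure Math. 17 (1989), §1
  p. 98 (1)–(4). [Greenberg1989]
* A. Wiles, *On ordinary λ-adic representations associated to modular forms*, Invent. Math. 94
  (1988), Thm. 2.2 (the ordinary filtration). [Wiles1988]
* C. Skinner, E. Urban, Invent. Math. 195 (2014), §3.1.3. [SkinnerUrban2014]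
-/

noncomputable section

open scoped Classical

open NumberField IsDedekindDomain Field
open Literature.NumberTheory.GaloisRepresentations
open _root_.Matrix
open scoped MatrixGroups

universe u

namespace Literature.NumberTheory.EllipticCurves.GreenbergSelmer

/-! ## The cofree module `A = T ⊗ F/𝒪` of a framed representation `ρ : G → GL_n(𝒪)` -/

section Cofree

variable {G : Type*} [Group G] [TopologicalSpace G]
variable (n : ℕ) (𝒪 : Type*) [CommRing 𝒪] [TopologicalSpace 𝒪] (F : Type*) [Field F] [Algebra 𝒪 F]

/-- The lattice `T = 𝒪ⁿ ⊆ Fⁿ` (image of `𝒪ⁿ → Fⁿ`), as an `𝒪`-submodule of `Fin n → F`.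
Greenberg 1989, p. 98: "Choose a lattice `T_p ⊆ V_p` which is invariant under the action of `G_ℚ`";
EPW §3.1: the integral model `ρ_f : G_ℚ → GL₂(𝒪)`. [cite: Greenberg1989, §1 p. 98] -/
def lattice : Submodule 𝒪 (Fin n → F) :=
  LinearMap.range ((Algebra.linearMap 𝒪 F).compLeft (Fin n))

variable {n 𝒪 F}

omit [TopologicalSpace 𝒪] in
/-- Membership in the lattice: `x = (algebraMap 𝒪 F) ∘ y` for some `y ∈ 𝒪ⁿ`. [cite: Greenberg1989, §1 p. 98] -/
theorem mem_lattice_iff (x : Fin n → F) :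
    x ∈ lattice n 𝒪 F ↔ ∃ y : Fin n → 𝒪, (fun i ↦ algebraMap 𝒪 F (y i)) = x :=
  LinearMap.mem_range

variable (F)

/-- The representation `ρ ⊗ F` of `G` on `Fⁿ` (`FramedRep.baseChangeRepresentation` along
`algebraMap 𝒪 F`), viewed `𝒪`-linearly. Greenberg 1989, p. 98 (`V_p ⊇ T_p`). [cite: Greenberg1989, §1 p. 98] -/
def fracRepresentation (ρ : FramedRep G 𝒪 n) : Representation 𝒪 G (Fin n → F) where
  toFun g := (FramedRep.baseChangeRepresentation (algebraMap 𝒪 F) ρ g).restrictScalars 𝒪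
  map_one' := by ext v i; simp
  map_mul' g h := by ext v i; simp

/-- Unfolding `fracRepresentation`: `g` acts on `Fⁿ` by the matrix `ρ(g)` (entries mapped to `F`).
[cite: Greenberg1989, §1 p. 98] -/
@[simp]
theorem fracRepresentation_apply_apply (ρ : FramedRep G 𝒪 n) (g : G) (x : Fin n → F) :
    fracRepresentation F ρ g x =
      (((ρ g : GL (Fin n) 𝒪) : Matrix (Fin n) (Fin n) 𝒪).map (algebraMap 𝒪 F)).mulVec x :=
  rfl

/-- The lattice `𝒪ⁿ ⊆ Fⁿ` is stable under `ρ ⊗ F` (`ρ` has entries in `𝒪`: `ρ(g)(ι ∘ y) = ι ∘ (ρ(g) y)`,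
`RingHom.map_mulVec`). Greenberg 1989, p. 98 ("invariant under the action of `G_ℚ`").
[cite: Greenberg1989, §1 p. 98] -/
theorem lattice_le_comap_fracRepresentation (ρ : FramedRep G 𝒪 n) (g : G) :
    lattice n 𝒪 F ≤ (lattice n 𝒪 F).comap (fracRepresentation F ρ g) := by
  intro x hx
  obtain ⟨y, rfl⟩ := (mem_lattice_iff x).1 hx
  refine Submodule.mem_comap.2 <| (mem_lattice_iff _).2 ⟨((ρ g : GL (Fin n) 𝒪) : Matrix (Fin n) (Fin n) 𝒪).mulVec y, ?_⟩
  ext i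
  rw [fracRepresentation_apply_apply]
  exact RingHom.map_mulVec (algebraMap 𝒪 F) _ y i

/-- **The cofree module `A = Fⁿ/𝒪ⁿ = T ⊗_𝒪 F/𝒪` of the framed representation `ρ : G → GL_n(𝒪)`**
("`A_p = V_p/T_p` which as a group is just `(ℚ_p/ℤ_p)^d`", Greenberg 1989, p. 98; "a cofree
`𝒪`-module of corank `2` with `G_ℚ`-action via `ρ_f`", EPW §3.1): a type synonym for the quotient
`𝒪`-module, carrying the discrete topology and the `G`-action induced by `ρ`
(`instDistribMulActionCofree`). [cite: EmertonPollackWeston2006, §3.1] -/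
@[nolint unusedArguments]
def Cofree (_ρ : FramedRep G 𝒪 n) (F : Type*) [Field F] [Algebra 𝒪 F] : Type _ :=
  (Fin n → F) ⧸ lattice n 𝒪 F

/-- `A` is an abelian group (instance plumbing). [folklore] -/
instance instAddCommGroupCofree (ρ : FramedRep G 𝒪 n) : AddCommGroup (Cofree ρ F) :=
  inferInstanceAs (AddCommGroup ((Fin n → F) ⧸ lattice n 𝒪 F))

/-- `A` is an `𝒪`-module (instance plumbing). [folklore] -/
instance instModuleCofree (ρ : FramedRep G 𝒪 n) : Module 𝒪 (Cofree ρ F) :=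
  inferInstanceAs (Module 𝒪 ((Fin n → F) ⧸ lattice n 𝒪 F))

/-- `A` carries the discrete topology. [folklore] -/
instance instTopologicalSpaceCofree (ρ : FramedRep G 𝒪 n) : TopologicalSpace (Cofree ρ F) := ⊥

/-- `A` is discrete. [folklore] -/
instance instDiscreteTopologyCofree (ρ : FramedRep G 𝒪 n) : DiscreteTopology (Cofree ρ F) :=
  ⟨rfl⟩

/-- The quotient map `Fⁿ → A = Fⁿ/𝒪ⁿ`, `𝒪`-linear. [cite: Greenberg1989, §1 p. 98] -/
def cofreeMk (ρ : FramedRep G 𝒪 n) :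
    (Fin n → F) →ₗ[𝒪] Cofree ρ F :=
  (lattice n 𝒪 F).mkQ

/-- `cofreeMk` is surjective. [cite: Greenberg1989, §1 p. 98] -/
theorem cofreeMk_surjective (ρ : FramedRep G 𝒪 n) : Function.Surjective (cofreeMk F ρ) :=
  Submodule.mkQ_surjective _

/-- The kernel of `Fⁿ → A` is the lattice `𝒪ⁿ`. [cite: Greenberg1989, §1 p. 98] -/
theorem ker_cofreeMk (ρ : FramedRep G 𝒪 n) : LinearMap.ker (cofreeMk F ρ) = lattice n 𝒪 F :=
  Submodule.ker_mkQ _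

/-- The representation of `G` on `A = Fⁿ/𝒪ⁿ` induced by `ρ ⊗ F` (Mathlib `Representation.quotient`,
well defined by `lattice_le_comap_fracRepresentation`). [cite: EmertonPollackWeston2006, §3.1] -/
def cofreeRepresentation
    (ρ : FramedRep G 𝒪 n) : Representation 𝒪 G (Cofree ρ F) :=
  (fracRepresentation F ρ).quotient (lattice n 𝒪 F) (lattice_le_comap_fracRepresentation F ρ)

/-- The induced representation on classes: `g · (x mod 𝒪ⁿ) = (ρ(g) x) mod 𝒪ⁿ`. [cite: EmertonPollackWeston2006, §3.1] -/
@[simp]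
theorem cofreeRepresentation_cofreeMk (ρ : FramedRep G 𝒪 n) (g : G) (x : Fin n → F) :
    cofreeRepresentation F ρ g (cofreeMk F ρ x) = cofreeMk F ρ (fracRepresentation F ρ g x) :=
  rfl

/-- **The `G`-action on `A = T ⊗ F/𝒪`** ("with `G_ℚ`-action via `ρ_f`", EPW §3.1), as a
`DistribMulAction` instance on the type synonym `Cofree ρ F` (so that the generic `H¹(H, A)` of file
`SubgroupSelmer` applies). [cite: EmertonPollackWeston2006, §3.1] -/
instance instDistribMulActionCofree (ρ : FramedRep G 𝒪 n) : DistribMulAction G (Cofree ρ F) where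
  smul g a := cofreeRepresentation F ρ g a
  one_smul a := by
    change cofreeRepresentation F ρ 1 a = a
    rw [map_one]; rfl
  mul_smul g h a := by
    change cofreeRepresentation F ρ (g * h) a =
      cofreeRepresentation F ρ g (cofreeRepresentation F ρ h a)
    rw [map_mul]; rfl
  smul_zero g := map_zero (cofreeRepresentation F ρ g)
  smul_add g a b := map_add (cofreeRepresentation F ρ g) a b

/-- Unfolding the action: `g • a = cofreeRepresentation F ρ g a`. [cite: EmertonPollackWeston2006, §3.1] -/
theorem smul_def (ρ : FramedRep G 𝒪 n) (g : G) (a : Cofree ρ F) :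
    g • a = cofreeRepresentation F ρ g a :=
  rfl

/-- The action on classes: `g • (x mod 𝒪ⁿ) = (ρ(g) x) mod 𝒪ⁿ`. [cite: EmertonPollackWeston2006, §3.1] -/
@[simp]
theorem smul_cofreeMk (ρ : FramedRep G 𝒪 n) (g : G) (x : Fin n → F) :
    g • cofreeMk F ρ x = cofreeMk F ρ (fracRepresentation F ρ g x) :=
  rfl

/-- The `G`-action on `A` is `𝒪`-linear (`A` is an `𝒪[G]`-module). [cite: EmertonPollackWeston2006, §3.1] -/
instance instSMulCommClassCofree (ρ : FramedRep G 𝒪 n) : SMulCommClass G 𝒪 (Cofree ρ F) :=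
  ⟨fun g r a ↦ (map_smul (cofreeRepresentation F ρ g) r a :)⟩

end Cofree

/-! ## Ordinary filtrations and the local datum `A' = T⁺ ⊗ F/𝒪 ⊆ A` -/

section Plus

variable {K : Type u} [Field K] [NumberField K]
variable {𝒪 : Type u} [CommRing 𝒪] [TopologicalSpace 𝒪] (F : Type u) [Field F] [Algebra 𝒪 F]
variable {n : ℕ}

/-- A **`D_v`-stable sublattice `T⁺_v ≤ T = 𝒪ⁿ`** of the framed Galois representation
`ρ : Γ_K → GL_n(𝒪)` at the finite place `v` (intended `v ∣ p`): an `𝒪`-submodule `plus` of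
`Fin n → 𝒪` stable under `ρ(res σ)` for all `σ ∈ Γ_{K_v}` — Greenberg's `F⁺T_p = T_p ∩ F⁺V_p`
((1), (4), p. 98: "`F⁺V_p` is invariant for the action of `G_{ℚ_p}`"); EPW §3.1 (eq:ordes): the
`𝒪[G_p]`-submodule of the ordinary filtration. [cite: Greenberg1989, §1 p. 98 (1), (4)] -/
structure PlusPart
    (ρ : FramedGaloisRep K 𝒪 n) (v : HeightOneSpectrum (𝓞 K)) where
  /-- The sublattice `T⁺_v ≤ 𝒪ⁿ`. -/
  plus : Submodule 𝒪 (Fin n → 𝒪)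
  /-- `T⁺_v` is stable under the decomposition group at the chosen prime above `v`. -/
  smul_mem : ∀ (σ : absoluteGaloisGroup (v.adicCompletion K)) {y : Fin n → 𝒪}, y ∈ plus →
    FramedRep.toRepresentation ρ (absGaloisRestrict K (v.adicCompletion K) σ) y ∈ plus

namespace PlusPart


variable {ρ : FramedGaloisRep K 𝒪 n} {v : HeightOneSpectrum (𝓞 K)} (P : PlusPart ρ v)

/-- `F⁺V = T⁺ ⊗ F ⊆ Fⁿ`: the `F`-span of the image of `T⁺_v` in `Fⁿ`. Greenberg 1989, p. 98, (1).
[cite: Greenberg1989, §1 p. 98 (1)] -/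
def plusF : Submodule F (Fin n → F) :=
  Submodule.span F ((fun y i ↦ algebraMap 𝒪 F (y i)) '' (P.plus : Set (Fin n → 𝒪)))

/-- `F⁺V` is stable under `ρ ⊗ F` restricted to the decomposition group. [cite: Greenberg1989, §1 p. 98 (1)(b)] -/
theorem plusF_le_comap (σ : absoluteGaloisGroup (v.adicCompletion K)) :
    P.plusF F ≤ (P.plusF F).comap
      (FramedRep.baseChangeRepresentation (algebraMap 𝒪 F) ρ (absGaloisRestrict K (v.adicCompletion K) σ)) := by
  rw [← Submodule.map_le_iff_le_comap, plusF, Submodule.map_span_le]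
  rintro _ ⟨y, hy, rfl⟩
  refine Submodule.subset_span ⟨_, P.smul_mem σ hy, ?_⟩
  ext i
  change algebraMap 𝒪 F ((((ρ (absGaloisRestrict K (v.adicCompletion K) σ) : GL (Fin n) 𝒪) :
      Matrix (Fin n) (Fin n) 𝒪).mulVec y) i) =
    ((((ρ (absGaloisRestrict K (v.adicCompletion K) σ) : GL (Fin n) 𝒪) :
      Matrix (Fin n) (Fin n) 𝒪).map (algebraMap 𝒪 F)).mulVec (fun i ↦ algebraMap 𝒪 F (y i))) i
  exact RingHom.map_mulVec (algebraMap 𝒪 F) _ y i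

/-- **`A'_v = F⁺A = T⁺_v ⊗ F/𝒪 ⊆ A`**: the image of `F⁺V` in `A = Fⁿ/𝒪ⁿ` ("`F⁺A_p` is its image in
`A_p`", Greenberg 1989 (4); EPW §3.1: `A'_{f}`), as an `𝒪`-submodule of `Cofree ρ F`.
[cite: Greenberg1989, §1 p. 98 (4)] -/
def cofreePlus : Submodule 𝒪 (Cofree ρ F) :=
  ((P.plusF F).restrictScalars 𝒪).map (cofreeMk F ρ)

/-- `A'_v` is stable under the decomposition group `D_v` acting on `A`. [cite: Greenberg1989, §1 p. 98 (4)] -/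
theorem smul_mem_cofreePlus (σ : absoluteGaloisGroup (v.adicCompletion K)) {a : Cofree ρ F}
    (ha : a ∈ P.cofreePlus F) :
    absGaloisRestrict K (v.adicCompletion K) σ • a ∈ P.cofreePlus F := by
  obtain ⟨x, hx, rfl⟩ := ha
  rw [smul_cofreeMk]
  exact ⟨_, P.plusF_le_comap F σ hx, rfl⟩

/-- **The ordinary local datum of `(ρ, T⁺_v)` on `A = Cofree ρ F`**: `M⁺_v := A'_v = T⁺_v ⊗ F/𝒪`
(a `LocalDatum`, file `GreenbergSelmer`). [cite: Greenberg1989, §1 p. 98 (4)] -/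
def localDatum : LocalDatum K (Cofree ρ F) v where
  plus := (P.cofreePlus F).toAddSubgroup
  smul_mem σ _ ha := P.smul_mem_cofreePlus F σ ha

/-- `A'_v` is an `𝒪`-submodule: scalars preserve the local datum (input of
`scalarH1_mem_selmerGroupOver`). [cite: EmertonPollackWeston2006, §3.1] -/
theorem smul_mem_localDatum_plus (r : 𝒪) {a : Cofree ρ F} (ha : a ∈ (P.localDatum F).plus) :
    r • a ∈ (P.localDatum F).plus :=
  (P.cofreePlus F).smul_mem r ha

end PlusPart

/-- An **ordinary filtration** of the two-dimensional framed Galois representation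
`ρ : Γ_K → GL₂(𝒪)` at the finite place `v` (intended `v ∣ p`): a `D_v`-stable line `T⁺_v ≤ T = 𝒪²`
(a `PlusPart`) which is a direct summand of rank one, with **unramified quotient** — the inertia group
`I_v` acts trivially on `T/T⁺_v`. This is the shape (eq:ordes) of EPW §3.1 for a `p`-ordinary
`p`-stabilised newform `f`: "`ρ|_{G_p} ≅ (ε^{k-1}χφ⁻¹ ∗ ; 0 φ)` with `φ : G_p → 𝒪^×` the unramified
character sending an arithmetic Frobenius to `a_p`" (by [Gross–Stevens]/Wiles 1988, Thm. 2.2), whose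
sub and quotient give `0 → A'_f → A_f → A''_f → 0`; Greenberg 1989, (1): the filtration `F^iV_p` with
`I_{ℚ_p}` acting on `gr^i` by `χ_p^i`. The characters themselves are not recorded (they are not used
by the Selmer group). [cite: EmertonPollackWeston2006, §3.1 (eq:ordes)] [cite: Wiles1988, Thm. 2.2] -/
structure OrdinaryFiltration
    (ρ : FramedGaloisRep K 𝒪 2) (v : HeightOneSpectrum (𝓞 K)) extends PlusPart ρ v where
  /-- `T⁺_v` is a direct summand of `T = 𝒪²` … -/
  exists_isCompl : ∃ C : Submodule 𝒪 (Fin 2 → 𝒪), IsCompl plus C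
  /-- … of rank one. -/
  finrank_eq_one : Module.finrank 𝒪 plus = 1
  /-- The quotient `T/T⁺_v` is unramified: inertia acts trivially on it. -/
  unramified : ∀ σ ∈ absInertia (v.adicCompletion K), ∀ y : Fin 2 → 𝒪,
    FramedRep.toRepresentation ρ (absGaloisRestrict K (v.adicCompletion K) σ) y - y ∈ plus

end Plus

/-! ## Greenberg's Selmer group of `(ρ, T⁺)` over `K_∞` and its invariants -/

section Newform

variable {K : Type u} [Field K] [NumberField K] {p : ℕ} [Fact p.Prime]
variable {𝒪 : Type u} [CommRing 𝒪] [TopologicalSpace 𝒪] (F : Type u) [Field F] [Algebra 𝒪 F]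
variable {n : ℕ} (κ : ZpExtension K p) (ρ : FramedGaloisRep K 𝒪 n)
  (P : ∀ v : HeightOneSpectrum (𝓞 K), ((p : ℕ) : 𝓞 K) ∈ v.asIdeal → PlusPart ρ v)

/-- The ordinary data of `(ρ, (T⁺_v)_{v ∣ p})` on `A = Cofree ρ F`. [cite: Greenberg1989, §1 p. 98 (4)] -/
def plusData : Data K (Cofree ρ F) p :=
  fun v hv ↦ (P v hv).localDatum F

/-- **`Sel(K_∞, A)` — Greenberg's Selmer group of the framed Galois representation `ρ : Γ_K → GL_n(𝒪)`
with ordinary data `(T⁺_v)_{v ∣ p}` over the `ℤ_p`-extension `K_∞ = K̄^{ker κ}`**, `A = T ⊗ F/𝒪`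
(`Cofree ρ F`): `selmerInfty κ A (plusData)` of file `GreenbergSelmer`, i.e.
`ker (H¹(K_∞, A) → ∏_{w ∤ p} H¹(K_{∞,w}, A) × ∏_{w ∣ p} H¹(I_w, A/A'_w))` — for `K = ℚ`, `n = 2`, `ρ = ρ_f`
the integral model of a `p`-ordinary `p`-stabilised newform and `κ` the cyclotomic `ℤ_p`-extension this
is `Sel(ℚ_∞, A_f)` of Emerton–Pollack–Weston §3.1 (with `i = 0`) = Greenberg's `S_{A}(ℚ_∞)`.
`-- TODO(general form): the twists A_{f,i} = A_f ⊗ ω^i, 0 ≤ i ≤ p-2, of EPW §3.1.`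
[cite: EmertonPollackWeston2006, §3.1] [cite: Greenberg1989, §1 p. 98 (2)–(4)] -/
def greenbergSelmer :
    AddSubgroup (subgroupH1 κ.kerSubgroup (Cofree ρ F)) :=
  selmerInfty κ (Cofree ρ F) (plusData F ρ P)

/-- The strict Selmer group of `(ρ, T⁺)` over `K_∞` (decomposition groups at `w ∣ p`), contained in
`greenbergSelmer` (`strictSelmerInfty_le`). Greenberg 1989, p. 98. [cite: Greenberg1989, §1 p. 98] -/
def strictGreenbergSelmer :
    AddSubgroup (subgroupH1 κ.kerSubgroup (Cofree ρ F)) :=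
  strictSelmerInfty κ (Cofree ρ F) (plusData F ρ P)

/-- `Sel^{str} ≤ Sel`. [cite: Greenberg1989, §1 p. 98] -/
theorem strictGreenbergSelmer_le : strictGreenbergSelmer F κ ρ P ≤ greenbergSelmer F κ ρ P :=
  strictSelmerInfty_le κ _ _

/-- `Sel(K_∞, A)` is stable under the conjugation action of `Γ_K` (`conjH1`), through which
`Γ = Gal(K_∞/K)` acts (EPW §3.1, "via the natural action of `Γ`"). [cite: EmertonPollackWeston2006, §3.1] -/
theorem conjH1_mem_greenbergSelmer (γ : absoluteGaloisGroup K)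
    {c : subgroupH1 κ.kerSubgroup (Cofree ρ F)} (hc : c ∈ greenbergSelmer F κ ρ P) :
    conjH1 κ.kerSubgroup (Cofree ρ F) γ c ∈ greenbergSelmer F κ ρ P :=
  conjH1_mem_selmerGroupOver γ hc

/-- `Sel(K_∞, A)` is an `𝒪`-submodule of `H¹(K_∞, A)`: stable under `scalarH1 r`, `r ∈ 𝒪`
(`scalarH1_mem_selmerGroupOver`; the `A'_v` are `𝒪`-submodules). [cite: EmertonPollackWeston2006, §3.1] -/
theorem scalarH1_mem_greenbergSelmer (r : 𝒪) {c : subgroupH1 κ.kerSubgroup (Cofree ρ F)}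
    (hc : c ∈ greenbergSelmer F κ ρ P) :
    scalarH1 κ.kerSubgroup (Cofree ρ F) r c ∈ greenbergSelmer F κ ρ P :=
  scalarH1_mem_selmerGroupOver κ.kerSubgroup r (fun v hv _ ha ↦ (P v hv).smul_mem_localDatum_plus F r ha) hc

/-- **The `π`-torsion `Sel(K_∞, A)[π]`** of Greenberg's Selmer group, for `π ∈ 𝒪` (intended: a
uniformiser): the classes of `Sel` killed by `scalarH1 π`. EPW Thm. 3.1.1: "`μ^alg(f)` vanishes if
and only if `Sel(ℚ_∞, A_f)[π]` is finite. If this is the case, then … `λ^alg(f) = dim_k Sel(ℚ_∞, A_f)[π]`."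
Statements needing "`μ^alg = 0`" in this currency take the hypothesis
`Finite (greenbergSelmerTorsionBy F κ ρ P π)` (the theorem itself is not asserted here).
[cite: EmertonPollackWeston2006, Thm. 3.1.1] -/
def greenbergSelmerTorsionBy
    (π : 𝒪) : AddSubgroup (subgroupH1 κ.kerSubgroup (Cofree ρ F)) :=
  greenbergSelmer F κ ρ P ⊓ (scalarH1 κ.kerSubgroup (Cofree ρ F) π).ker

/-- Membership in `Sel[π]`: `c ∈ Sel` and `π · c = 0`. [cite: EmertonPollackWeston2006, Thm. 3.1.1] -/
theorem mem_greenbergSelmerTorsionBy_iff (π : 𝒪) (c : subgroupH1 κ.kerSubgroup (Cofree ρ F)) :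
    c ∈ greenbergSelmerTorsionBy F κ ρ P π ↔
      c ∈ greenbergSelmer F κ ρ P ∧ scalarH1 κ.kerSubgroup (Cofree ρ F) π c = 0 :=
  Iff.rfl

/-- `Sel[π] ≤ Sel`. [cite: EmertonPollackWeston2006, Thm. 3.1.1] -/
theorem greenbergSelmerTorsionBy_le (π : 𝒪) :
    greenbergSelmerTorsionBy F κ ρ P π ≤ greenbergSelmer F κ ρ P :=
  inf_le_left

/-- **`dim_k Sel(K_∞, A)[π]`**, `k = 𝒪/π`, written as `log_{#k} #Sel[π]` (for a finite-dimensional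
`k`-vector space `#V = #k ^ dim V`; junk value when `Sel[π]` or `k` is infinite, `Nat.card = 0`):
by EPW Thm. 3.1.1 this is `λ^alg(f)` when `μ^alg(f) = 0` (not asserted here).
[cite: EmertonPollackWeston2006, Thm. 3.1.1] -/
def selmerTorsionDim
    (π : 𝒪) : ℕ :=
  Nat.log (Nat.card (𝒪 ⧸ Ideal.span {π})) (Nat.card (greenbergSelmerTorsionBy F κ ρ P π))

end Newform

/-! ## The `Λ_𝒪`-dual of `Sel(K_∞, A)` as a hypothesis structure -/

section Dual

variable {K : Type u} [Field K] [NumberField K] {p : ℕ} [Fact p.Prime]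
variable {𝒪 : Type u} [CommRing 𝒪] [TopologicalSpace 𝒪] (F : Type u) [Field F] [Algebra 𝒪 F]
variable {n : ℕ} (κ : ZpExtension K p) (γ : absoluteGaloisGroup K) (ρ : FramedGaloisRep K 𝒪 n)
  (P : ∀ v : HeightOneSpectrum (𝓞 K), ((p : ℕ) : 𝓞 K) ∈ v.asIdeal → PlusPart ρ v)

/-- **Pontryagin-dual data for Greenberg's Selmer group `Sel(K_∞, A)`** over
`Λ_𝒪 = 𝒪⟦T⟧ = PowerSeries 𝒪` — the verbatim analogue of `WeierstrassCurve.SelmerDualData` (file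
`IwasawaSelmer`) for `A = T ⊗ F/𝒪` in place of `E[p^∞]` and `𝒪` in place of `ℤ_p`: an abstract
`Λ_𝒪`-module `X` ("the `Λ_𝒪`-dual of `Sel(ℚ_∞, A_f)`", EPW §3.1/§5.1) with a group isomorphism
`toDual : X ≃ Hom(Sel, ℚ/ℤ)` (`ℚ/ℤ = AddCircle (1 : ℚ)` receives all characters of the torsion group
`Sel`), `T` acting as `γ - 1` through the conjugation action (`conjH1`, which preserves `Sel`:
`conjH1_mem_greenbergSelmer`) and the constants `a ∈ 𝒪` acting through the `𝒪`-module structure of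
`Sel` (`scalarH1`, which preserves `Sel`: `scalarH1_mem_greenbergSelmer`). Intended with `κ`
cyclotomic and `γ` a topological generator (`κ.IsTopGenerator γ`). Existence, uniqueness and
cotorsion (EPW Thm. 3.1.1, [KKT]) are NOT asserted; statements consume a datum `D` as a hypothesis.
[cite: EmertonPollackWeston2006, §3.1 and §5.1] -/
structure DualData
    (F : Type u) [Field F] [Algebra 𝒪 F] (κ : ZpExtension K p) (γ : absoluteGaloisGroup K)
    (ρ : FramedGaloisRep K 𝒪 n)
    (P : ∀ v : HeightOneSpectrum (𝓞 K), ((p : ℕ) : 𝓞 K) ∈ v.asIdeal → PlusPart ρ v) where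
  /-- The underlying type of the Iwasawa module `X = Sel(K_∞, A)^∨`. -/
  X : Type u
  /-- `X` is an abelian group. -/
  [addCommGroup : AddCommGroup X]
  /-- `X` is a `Λ_𝒪 = 𝒪⟦T⟧`-module. -/
  [module : Module (PowerSeries 𝒪) X]
  /-- The identification of `X` with the character group `Hom(Sel, ℚ/ℤ)`. -/
  toDual : X →+ (greenbergSelmer F κ ρ P →+ AddCircle (1 : ℚ))
  /-- `toDual` is a group isomorphism. -/
  bijective : Function.Bijective toDual
  /-- `T` acts as `γ - 1`: `(T·x)(s) = x(conj_γ s) - x(s)`. -/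
  toDual_T_smul : ∀ (x : X) (s : greenbergSelmer F κ ρ P),
    toDual ((PowerSeries.X : PowerSeries 𝒪) • x) s =
      toDual x ⟨conjH1 κ.kerSubgroup (Cofree ρ F) γ s, conjH1_mem_greenbergSelmer F κ ρ P γ s.2⟩ -
        toDual x s
  /-- Constants `a ∈ 𝒪` act through the `𝒪`-module structure of `Sel`: `(a·x)(s) = x(a·s)`. -/
  toDual_C_smul : ∀ (a : 𝒪) (x : X) (s : greenbergSelmer F κ ρ P),
    toDual (PowerSeries.C a • x) s =
      toDual x ⟨scalarH1 κ.kerSubgroup (Cofree ρ F) a s, scalarH1_mem_greenbergSelmer F κ ρ P a s.2⟩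

/-- The dual `X` of a datum is an abelian group (the bundled structure, as an instance). [folklore] -/
instance DualData.instAddCommGroupX (D : DualData F κ γ ρ P) : AddCommGroup D.X :=
  D.addCommGroup

/-- The dual `X` of a datum is a `Λ_𝒪`-module (the bundled structure, as an instance). [folklore] -/
instance DualData.instModuleX (D : DualData F κ γ ρ P) : Module (PowerSeries 𝒪) D.X :=
  D.module

namespace DualData


variable {F κ γ ρ P} (D : DualData F κ γ ρ P)

/-- The **characteristic ideal** `char_{Λ_𝒪}(X) ⊆ Λ_𝒪` of the dual of `Sel(K_∞, A)`
(`Literature.NumberTheory.EllipticCurves.Module.charIdeal`, the product of the height-one primes to the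
local lengths); a generator is EPW's "characteristic power series of the `Λ_𝒪`-dual of
`Sel(ℚ_∞, A_f)`" = `L_p^alg(f)` (§5.1), whose `π`-adic valuation and Weierstrass degree are
`μ^alg(f)`, `λ^alg(f)` (§3.1). That `X` is finitely generated and torsion over `Λ_𝒪`
(EPW Thm. 3.1.1: "co-finitely generated, `Λ_𝒪`-cotorsion" [Greenberg 1989], [Kato]) is NOT asserted;
statements take `Module.Finite (PowerSeries 𝒪) D.X` / `Module.IsTorsion (PowerSeries 𝒪) D.X` as
hypotheses. [cite: EmertonPollackWeston2006, §3.1 and §5.1] -/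
def charIdeal : Ideal (PowerSeries 𝒪) :=
  Literature.NumberTheory.EllipticCurves.Module.charIdeal (PowerSeries 𝒪) D.X

end DualData

end Dual

end Literature.NumberTheory.EllipticCurves.GreenbergSelmer

end
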